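import Summits.AtomisticToContinuum.Crystallization.Theorems.ChartedZeroExcessLayeredLatticeLiouvilleZZZUA

/-!
# ChartedZeroExcess · LayeredLatticeLiouville ZZZUB (lens-2 g88 NODE 88 «MotionDichotomy», part 2 of 3) — the collar price for two
# registered/pinned index families, and THE COLLAR FRAME from the covering radius of clean sets

Part 1 (`…ZZZUA`) carries the node's module docstring (thesis, pieces, net, constants, erratum) and sections ZZZU-1 (frame algebra) and
ZZZU-2 (the two prices); this part: ZZZU-2′ (`rigidMisfit_collar_farId'`, the collar price in the shape the frame delivers) and ZZZU-3
(`exists_collarProbe`, `probe_ne`, `exists_collarFrame`: six ε-registered, dI₁-pinned, pairwise distinct core sites at the ends of three perturbed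
axes, for every finite nonempty container, from `IsDoorSetP` cleanness with `aHi ≤ 8/7` and the bond-label clauses); part 3 (`…ZZZU`) states the
pieces (BXᴸ)/(UXᴸ) and proves the glue and the W2⁗ doors.  0 sorry; imports = part 1 only.
-/

noncomputable section
open scoped BigOperators Classical InnerProductSpace RealInnerProductSpace
open MeasureTheory Set Metric Filter Topology
open Literature.Geometry.DiscreteGeometry (IsTwoShellGoodSet)
open Literature.MathematicalPhysics.StatisticalMechanics (lennardJones card_le_of_separated_of_dist_le)

namespace Summit.AtomisticToContinuum.Crystallization.Theorems.ChartedZeroExcessLayeredLatticeLiouville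

open Summit.AtomisticToContinuum.Crystallization.Theorems.ChartedPlanarOrderRigidityDoor (E3 IsClean)
open Summit.AtomisticToContinuum.Crystallization.Theorems.ChartedPlanarOrderDensityDichotomy (μS IsSep)
open Summit.AtomisticToContinuum.Crystallization.Theorems.ChartedPlanarOrderCleanScaleP (IsCleanP IsDoorSetP)
open Summit.AtomisticToContinuum.Crystallization.Theorems.ChartedPlanarOrderMesoCut (LayeredHom EnvClose)
open Summit.AtomisticToContinuum.Crystallization.Theorems.ChartedPlanarOrderDoorLayeredOsc (IsTwoShellAffineGood)

/-- the collar price with the six sites given as a PLUS triple `ip` and a MINUS triple `im` (the form the collar frame delivers). [formal bookkeeping] -/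
theorem fin_two_eq_zero_or_one : ∀ σ : Fin 2, σ = 0 ∨ σ = 1 := Fin.forall_fin_two.2 ⟨Or.inl rfl, Or.inr rfl⟩

section Prices'

variable {n : ℕ} {y₀ y xf : Fin n → E3} {R : E3 ≃ₗᵢ[ℝ] E3} {c : E3}

/-- ★★ the collar price (`rigidMisfit_collar_farId`) with the six sites given as a PLUS triple `ip` and a MINUS triple `im`. [this file, g88] -/
theorem rigidMisfit_collar_farId' (b : OrthonormalBasis (Fin 3) ℝ E3) (ip im : Fin 3 → Fin n) {ε dI₁ L w κ t u : ℝ}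
    (hip : Function.Injective ip) (him : Function.Injective im) (hpm : ∀ m m', ip m ≠ im m')
    (hregp : ∀ m, dist (xf (ip m)) (y₀ (ip m)) ≤ ε) (hregm : ∀ m, dist (xf (im m)) (y₀ (im m)) ≤ ε)
    (hpinp : ∀ m, dist (y (ip m)) (y₀ (ip m)) ≤ dI₁) (hpinm : ∀ m, dist (y (im m)) (y₀ (im m)) ≤ dI₁) (hL : 0 ≤ L)
    (hax : ∀ m, L ≤ ⟪y₀ (ip m) - y₀ (im m), b m⟫_ℝ)
    (hperp : ∀ m, ‖(y₀ (ip m) - y₀ (im m)) - ⟪y₀ (ip m) - y₀ (im m), b m⟫_ℝ • b m‖ ≤ w)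
    (ht : t ^ 2 ≤ L ^ 2 / 2 - 2 * w ^ 2) (hu0 : 0 ≤ u) (hu : 3 ≤ u ^ 2) (hκ : 0 ≤ κ)
    (hfar : ∃ v : E3, κ * ‖v‖ < ‖R v - v‖) (hB : 0 ≤ t * κ - 2 * u * (ε + dI₁)) :
    (t * κ - 2 * u * (ε + dI₁)) ^ 2 / 2 ≤ rigidMisfit y xf R c := by
  refine rigidMisfit_collar_farId (y₀ := y₀) b (fun m => ![ip m, im m]) ?_ ?_ ?_ hL ?_ ?_ ht hu0 hu hκ hfar hB
  · intro m σ m' σ' h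
    rcases fin_two_eq_zero_or_one σ with rfl | rfl <;> rcases fin_two_eq_zero_or_one σ' with rfl | rfl <;>
      simp only [Matrix.cons_val_zero, Matrix.cons_val_one] at h
    · exact ⟨hip h, rfl⟩
    · exact absurd h (hpm m m')
    · exact absurd h.symm (hpm m' m)
    · exact ⟨him h, rfl⟩
  · intro m σ
    rcases fin_two_eq_zero_or_one σ with rfl | rfl
    · simp only [Matrix.cons_val_zero]; exact hregp m
    · simp only [Matrix.cons_val_one]; exact hregm m
  · intro m σ
    rcases fin_two_eq_zero_or_one σ with rfl | rfl
    · simp only [Matrix.cons_val_zero]; exact hpinp m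
    · simp only [Matrix.cons_val_one]; exact hpinm m
  · intro m; simp only [Matrix.cons_val_zero, Matrix.cons_val_one]; exact hax m
  · intro m; simp only [Matrix.cons_val_zero, Matrix.cons_val_one]; exact hperp m

end Prices'

/-! ### ZZZU-3  The collar frame: six registered, interface-pinned core sites at the ends of three perturbed axes, from the covering radius
`< 9/10` of clean separated sets (tree TW) and the collar clauses of the bond label and of the inner tube -/

section CollarFrame

/-- `⟪v, u⟫ ≤ dist`-form of Cauchy–Schwarz for a unit vector. [formal bookkeeping] -/
theorem inner_sub_le_dist {u : E3} (hu : ‖u‖ = 1) (p k : E3) : ⟪p - k, u⟫_ℝ ≤ dist p k := by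
  rw [dist_eq_norm]
  calc ⟪p - k, u⟫_ℝ ≤ ‖p - k‖ * ‖u‖ := real_inner_le_norm _ _
    _ = ‖p - k‖ := by rw [hu, mul_one]

/-- a point `p` within `a` of `z` has `⟪p, u⟫ > ⟪z, u⟫ − a` (unit `u`). [formal bookkeeping] -/
theorem inner_sub_lt_of_dist_lt {u : E3} (hu : ‖u‖ = 1) {z p : E3} {a : ℝ} (h : dist z p < a) : ⟪z, u⟫_ℝ - a < ⟪p, u⟫_ℝ := by
  have h1 := inner_sub_le_dist hu z p
  rw [inner_sub_left] at h1
  linarith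

/-- a point `p` within `a` of `z` has `⟪p, u⟫ < ⟪z, u⟫ + a` (unit `u`). [formal bookkeeping] -/
theorem inner_lt_add_of_dist_lt {u : E3} (hu : ‖u‖ = 1) {z p : E3} {a : ℝ} (h : dist z p < a) : ⟪p, u⟫_ℝ < ⟪z, u⟫_ℝ + a := by
  have h1 := inner_sub_le_dist hu p z
  rw [inner_sub_left, dist_comm] at h1
  linarith

/-- removing the component along a unit basis vector does not increase the norm. [formal bookkeeping] -/
theorem norm_sub_inner_smul_le (b : OrthonormalBasis (Fin 3) ℝ E3) (m : Fin 3) (v : E3) : ‖v - ⟪v, b m⟫_ℝ • b m‖ ≤ ‖v‖ := by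
  rw [real_inner_comm (b m) v]
  have hn : ‖v - ⟪b m, v⟫_ℝ • b m‖ ^ 2 = ‖v‖ ^ 2 - ⟪b m, v⟫_ℝ ^ 2 := by
    rw [← real_inner_self_eq_norm_sq, inner_sub_left, inner_sub_right, inner_sub_right, real_inner_smul_left, real_inner_smul_right,
      real_inner_smul_left, real_inner_smul_right, real_inner_self_eq_norm_sq, real_inner_self_eq_norm_sq, b.orthonormal.1 m,
      real_inner_comm v (b m)]
    ring
  exact (abs_le_of_sq_le_sq' (by rw [hn]; nlinarith [sq_nonneg ⟪b m, v⟫_ℝ]) (norm_nonneg v)).2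

/-- the off-axis part of `a + t • b m + c` has norm `≤ ‖a‖ + ‖c‖`. [formal bookkeeping] -/
theorem norm_perp_decomp_le (b : OrthonormalBasis (Fin 3) ℝ E3) (m : Fin 3) (a c : E3) (t : ℝ) :
    ‖(a + t • b m + c) - ⟪a + t • b m + c, b m⟫_ℝ • b m‖ ≤ ‖a‖ + ‖c‖ := by
  have h1 : ⟪b m, b m⟫_ℝ = 1 := by rw [real_inner_self_eq_norm_sq, b.orthonormal.1 m]; norm_num
  have key : (a + t • b m + c) - ⟪a + t • b m + c, b m⟫_ℝ • b m = (a - ⟪a, b m⟫_ℝ • b m) + (c - ⟪c, b m⟫_ℝ • b m) := by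
    rw [inner_add_left, inner_add_left, real_inner_smul_left, h1, mul_one, add_smul, add_smul]
    abel
  rw [key]
  exact (norm_add_le _ _).trans (add_le_add (norm_sub_inner_smul_le b m a) (norm_sub_inner_smul_le b m c))

/-- two collar probes in directions at an obtuse-or-right angle land on DISTINCT atoms (`rC ≥ 9/5`). [formal bookkeeping] -/
theorem probe_ne {K : Set E3} {u u' k k' p p' : E3} {rC : ℝ} (hu : ‖u‖ = 1) (hrC : 9 / 5 ≤ rC)
    (hkmax : ∀ k'' ∈ K, ⟪k'', u⟫_ℝ ≤ ⟪k, u⟫_ℝ) (hk' : k' ∈ K) (huu' : ⟪u', u⟫_ℝ ≤ 0)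
    (hp : dist (k + rC • u) p < 9 / 10) (hp' : dist (k' + rC • u') p' < 9 / 10) : p ≠ p' := by
  have h1 := inner_sub_lt_of_dist_lt hu hp
  have h2 := inner_lt_add_of_dist_lt hu hp'
  have e1 : ⟪k + rC • u, u⟫_ℝ = ⟪k, u⟫_ℝ + rC := by
    rw [inner_add_left, real_inner_smul_left, real_inner_self_eq_norm_sq, hu]; ring
  have e2 : ⟪k' + rC • u', u⟫_ℝ = ⟪k', u⟫_ℝ + rC * ⟪u', u⟫_ℝ := by rw [inner_add_left, real_inner_smul_left]
  have h3 := hkmax k' hk'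
  have h4 : rC * ⟪u', u⟫_ℝ ≤ 0 := by nlinarith
  intro hpp
  rw [hpp] at h1
  linarith

variable {aHi δ q ρ rΘ ℓ ε Rg sb₁ dI₁ dB₁ rC : ℝ} {S K C : Set E3} {x₀ : E3} {n : ℕ} {xf y : Fin n → E3} {lab : E3 → E3}

/-- ★★ **THE COLLAR PROBE (PROVED)**: in a unit direction `u`, with `k ∈ K` maximising `⟪·, u⟫` over the (finite, nonempty) container, the atom of the
clean door set within `9/10` of `k + rC • u` (covering radius, tree TW) is a CORE site `xf i` (`rC + 9/10 ≤ ρ`), lies in the COOL zone (`⟪xf i − k', u⟫ >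
rC − 9/10 > rΘ` for every `k' ∈ K`), hence is REGISTERED by the bond label (`dist (xf i) (lab (xf i)) ≤ ε`), and its label is within `Rg` of an EXTERIOR
atom (the probe at `k + (ρ + 9/10) • u`), hence `y` is INTERFACE-PINNED there (`dist (y i) (lab (xf i)) ≤ dI₁`). [this file, g88] -/
theorem exists_collarProbe (haHi : aHi ≤ 8 / 7) (hδ : 0 < δ) (hS : IsDoorSetP aHi δ S) (hKfin : K.Finite) (hKne : K.Nonempty)
    (hrange : Set.range xf = coreOf S K ρ) (hlab : IsBondLabel ε rΘ ℓ S K C lab)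
    (hyT : y ∈ bondTube (S \ coreOf S K ρ) Rg sb₁ dI₁ dB₁ (fun i => lab (xf i)))
    (hrC : 9 / 5 ≤ rC) (hcool : rΘ + 9 / 10 < rC) (hcore : rC + 9 / 10 ≤ ρ) (hρℓ : ρ ≤ ℓ) (hext : ε + 27 / 10 + ρ - rC ≤ Rg)
    {u : E3} (hu : ‖u‖ = 1) :
    ∃ (k : E3) (i : Fin n), k ∈ K ∧ (∀ k' ∈ K, ⟪k', u⟫_ℝ ≤ ⟪k, u⟫_ℝ) ∧ dist (k + rC • u) (xf i) < 9 / 10 ∧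
      dist (xf i) (lab (xf i)) ≤ ε ∧ dist (y i) (lab (xf i)) ≤ dI₁ := by
  have hcov : ∀ z : E3, ∃ p ∈ S, dist z p < 9 / 10 := fun z =>
    exists_mem_dist_lt_nine_tenths_of_cleanP haHi hδ hS.2.1 hS.2.2.1 ⟨0, hS.1⟩ z
  have hrC0 : 0 ≤ rC := by linarith
  obtain ⟨k, hkK, hkmax⟩ := Set.exists_max_image K (fun k => ⟪k, u⟫_ℝ) hKfin hKne
  obtain ⟨p, hpS, hpd⟩ := hcov (k + rC • u)
  have e1 : ⟪k + rC • u, u⟫_ℝ = ⟪k, u⟫_ℝ + rC := by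
    rw [inner_add_left, real_inner_smul_left, real_inner_self_eq_norm_sq, hu]; ring
  have hpu : ⟪k, u⟫_ℝ + rC - 9 / 10 < ⟪p, u⟫_ℝ := by have := inner_sub_lt_of_dist_lt hu hpd; linarith
  have hcoolp : ∀ k' ∈ K, rC - 9 / 10 < dist p k' := fun k' hk' => by
    have h1 := inner_sub_le_dist hu p k'
    rw [inner_sub_left] at h1
    have h3 := hkmax k' hk'
    linarith
  have hzk : dist (k + rC • u) k = rC := by
    rw [dist_eq_norm, add_sub_cancel_left, norm_smul, hu, mul_one, Real.norm_eq_abs, abs_of_nonneg hrC0]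
  have hpk : dist p k < rC + 9 / 10 := by
    have := dist_triangle p (k + rC • u) k
    rw [dist_comm p (k + rC • u), hzk] at this
    linarith
  have hpcore : p ∈ coreOf S K ρ := ⟨hpS, k, hkK, by linarith⟩
  obtain ⟨i, hi⟩ : p ∈ Set.range xf := by rw [hrange]; exact hpcore
  have hzone : ∃ k' ∈ K, dist p k' < ℓ := ⟨k, hkK, by linarith⟩
  have hcoolz : ∀ k' ∈ K, rΘ < dist p k' := fun k' hk' => by have := hcoolp k' hk'; linarith
  have hreg : dist p (lab p) ≤ ε := hlab.2.2.2 p hpS hzone hcoolz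
  -- the exterior atom and the interface pin
  obtain ⟨p', hp'S, hp'd⟩ := hcov (k + (ρ + 9 / 10) • u)
  have hp'out : p' ∈ S \ coreOf S K ρ := by
    refine ⟨hp'S, fun hc => ?_⟩
    obtain ⟨_, k', hk', hd⟩ := hc
    have h1 := inner_sub_le_dist hu p' k'
    rw [inner_sub_left] at h1
    have h3 := hkmax k' hk'
    have h4 : ⟪k + (ρ + 9 / 10) • u, u⟫_ℝ = ⟪k, u⟫_ℝ + (ρ + 9 / 10) := by
      rw [inner_add_left, real_inner_smul_left, real_inner_self_eq_norm_sq, hu]; ring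
    have h5 := inner_sub_lt_of_dist_lt hu hp'd
    linarith
  have hlabp' : dist (lab p) p' ≤ Rg := by
    have h1 : dist (k + rC • u) (k + (ρ + 9 / 10) • u) = ρ + 9 / 10 - rC := by
      rw [dist_eq_norm, add_sub_add_left_eq_sub, ← sub_smul, norm_smul, hu, mul_one, Real.norm_eq_abs,
        abs_of_nonpos (by linarith : rC - (ρ + 9 / 10) ≤ 0)]
      ring
    have h2 : dist (k + rC • u) p' ≤ (ρ + 9 / 10 - rC) + 9 / 10 := by
      have := dist_triangle (k + rC • u) (k + (ρ + 9 / 10) • u) p'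
      rw [h1] at this
      linarith
    have h3 := dist_triangle4 (lab p) p (k + rC • u) p'
    rw [dist_comm (lab p) p, dist_comm p (k + rC • u)] at h3
    linarith
  have hpin : dist (y i) (lab (xf i)) ≤ dI₁ := hyT.2.1 i ⟨p', hp'out, by show dist (lab (xf i)) p' ≤ Rg; rw [hi]; exact hlabp'⟩
  exact ⟨k, i, hkK, hkmax, by rw [hi]; exact hpd, by rw [hi]; exact hreg, hpin⟩

/-- ★★★ **THE COLLAR FRAME (PROVED)**: under the container / core / label / inner-tube clauses of the (TGᴸ) binders (clean `aHi`-door set, `aHi ≤ 8/7`,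
`K ⊆ S` finite-diameter `≤ 2q` and nonempty, `xf` enumerating the `ρ`-core, bond label `lab`, `y` in the inner tube) and the dial inequalities
`9/5 ≤ rC`, `rΘ + 9/10 < rC`, `rC + 9/10 ≤ ρ ≤ ℓ`, `ε + 27/10 + ρ − rC ≤ Rg`, there are six pairwise distinct core sites `ip m`, `im m` (`m : Fin 3`),
registered (`≤ ε`), interface-pinned for `y` (`≤ dI₁`), whose label differences `lab (xf (ip m)) − lab (xf (im m))` have component `≥ 2rC − 2(9/10 + ε)`
along the `m`-th axis of the orthonormal basis `b` and off-axis part of norm `≤ 2q + 2(9/10 + ε)`.  (Six probes `±b m` of `exists_collarProbe`;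
distinctness by `probe_ne`; the axis bounds from the extremality of the probe bases in `K`.) [this file, g88] -/
theorem exists_collarFrame (b : OrthonormalBasis (Fin 3) ℝ E3) (haHi : aHi ≤ 8 / 7) (hδ : 0 < δ) (hS : IsDoorSetP aHi δ S) (hKS : K ⊆ S)
    (hKq : ∀ k ∈ K, dist k x₀ ≤ q) (hKne : K.Nonempty) (hrange : Set.range xf = coreOf S K ρ)
    (hlab : IsBondLabel ε rΘ ℓ S K C lab) (hyT : y ∈ bondTube (S \ coreOf S K ρ) Rg sb₁ dI₁ dB₁ (fun i => lab (xf i)))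
    (hrC : 9 / 5 ≤ rC) (hcool : rΘ + 9 / 10 < rC) (hcore : rC + 9 / 10 ≤ ρ) (hρℓ : ρ ≤ ℓ) (hext : ε + 27 / 10 + ρ - rC ≤ Rg) :
    ∃ ip im : Fin 3 → Fin n, Function.Injective ip ∧ Function.Injective im ∧ (∀ m m', ip m ≠ im m') ∧
      (∀ m, dist (xf (ip m)) (lab (xf (ip m))) ≤ ε) ∧ (∀ m, dist (xf (im m)) (lab (xf (im m))) ≤ ε) ∧
      (∀ m, dist (y (ip m)) (lab (xf (ip m))) ≤ dI₁) ∧ (∀ m, dist (y (im m)) (lab (xf (im m))) ≤ dI₁) ∧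
      (∀ m, 2 * rC - 2 * (9 / 10 + ε) ≤ ⟪lab (xf (ip m)) - lab (xf (im m)), b m⟫_ℝ) ∧
      (∀ m, ‖(lab (xf (ip m)) - lab (xf (im m))) - ⟪lab (xf (ip m)) - lab (xf (im m)), b m⟫_ℝ • b m‖ ≤ 2 * q + 2 * (9 / 10 + ε)) := by
  have hKfin : K.Finite :=
    (Literature.Probability.Process.LocalConfig.finite_inter_of_separated hδ hS.2.1 (isCompact_closedBall x₀ q)).subset
      fun k hk => ⟨mem_closedBall.2 (hKq k hk), hKS hk⟩
  have hb1 : ∀ m, ‖b m‖ = 1 := fun m => b.orthonormal.1 m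
  have hb1' : ∀ m, ‖-b m‖ = 1 := fun m => by rw [norm_neg, hb1]
  have hbb : ∀ m m', ⟪b m', b m⟫_ℝ = if m' = m then 1 else 0 := fun m m' => orthonormal_iff_ite.1 b.orthonormal m' m
  have P := fun m => exists_collarProbe haHi hδ hS hKfin hKne hrange hlab hyT hrC hcool hcore hρℓ hext (hb1 m)
  have M := fun m => exists_collarProbe haHi hδ hS hKfin hKne hrange hlab hyT hrC hcool hcore hρℓ hext (hb1' m)
  choose kp ip hkpK hkpmax hipd hipreg hippin using P
  choose km im hkmK hkmmax himd himreg himpin using M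
  refine ⟨ip, im, fun m m' h => ?_, fun m m' h => ?_, fun m m' h => ?_, hipreg, himreg, hippin, himpin, fun m => ?_, fun m => ?_⟩
  · by_contra hne
    have h0 : ⟪b m', b m⟫_ℝ ≤ 0 := by rw [hbb, if_neg (Ne.symm hne)]
    exact probe_ne (hb1 m) hrC (hkpmax m) (hkpK m') h0 (hipd m) (hipd m') (congrArg xf h)
  · by_contra hne
    have h0 : ⟪-b m', -b m⟫_ℝ ≤ 0 := by rw [inner_neg_neg, hbb, if_neg (Ne.symm hne)]
    exact probe_ne (hb1' m) hrC (hkmmax m) (hkmK m') h0 (himd m) (himd m') (congrArg xf h)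
  · have h0 : ⟪-b m', b m⟫_ℝ ≤ 0 := by
      rw [inner_neg_left, hbb]; split_ifs <;> norm_num
    exact probe_ne (hb1 m) hrC (hkpmax m) (hkmK m') h0 (hipd m) (himd m') (congrArg xf h)
  · -- the axial component
    have e1 : ⟪kp m + rC • b m, b m⟫_ℝ = ⟪kp m, b m⟫_ℝ + rC := by
      rw [inner_add_left, real_inner_smul_left, real_inner_self_eq_norm_sq, hb1]; ring
    have e2 : ⟪km m + rC • -b m, b m⟫_ℝ = ⟪km m, b m⟫_ℝ - rC := by
      rw [inner_add_left, real_inner_smul_left, inner_neg_left, real_inner_self_eq_norm_sq, hb1]; ring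
    have h1 := inner_sub_lt_of_dist_lt (hb1 m) (hipd m)
    have h2 := inner_sub_lt_of_dist_lt (hb1' m) (himd m)
    have h3 := inner_sub_le_dist (hb1 m) (xf (ip m)) (lab (xf (ip m)))
    have h4 := inner_sub_le_dist (hb1' m) (xf (im m)) (lab (xf (im m)))
    simp only [inner_neg_right, inner_sub_left] at h2 h3 h4
    have h5 := hkpmax m (km m) (hkmK m)
    have h6 := hipreg m
    have h7 := himreg m
    rw [inner_sub_left]
    linarith
  · -- the off-axis part
    have hdec : lab (xf (ip m)) - lab (xf (im m)) = (kp m - km m) + (2 * rC) • b m +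
        ((lab (xf (ip m)) - (kp m + rC • b m)) - (lab (xf (im m)) - (km m + rC • -b m))) := by
      rw [smul_neg, mul_smul, two_smul]; abel
    rw [hdec]
    refine (norm_perp_decomp_le b m _ _ _).trans (add_le_add ?_ ?_)
    · rw [← dist_eq_norm]
      have := dist_triangle (kp m) x₀ (km m)
      rw [dist_comm x₀] at this
      linarith [hKq _ (hkpK m), hKq _ (hkmK m)]
    · have hA : ‖lab (xf (ip m)) - (kp m + rC • b m)‖ ≤ 9 / 10 + ε := by
        rw [← dist_eq_norm]
        have := dist_triangle (lab (xf (ip m))) (xf (ip m)) (kp m + rC • b m)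
        rw [dist_comm (lab (xf (ip m))) (xf (ip m)), dist_comm (xf (ip m)) (kp m + rC • b m)] at this
        linarith [hipreg m, hipd m]
      have hB : ‖lab (xf (im m)) - (km m + rC • -b m)‖ ≤ 9 / 10 + ε := by
        rw [← dist_eq_norm]
        have := dist_triangle (lab (xf (im m))) (xf (im m)) (km m + rC • -b m)
        rw [dist_comm (lab (xf (im m))) (xf (im m)), dist_comm (xf (im m)) (km m + rC • -b m)] at this
        linarith [himreg m, himd m]
      linarith [norm_sub_le (lab (xf (ip m)) - (kp m + rC • b m)) (lab (xf (im m)) - (km m + rC • -b m))]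

end CollarFrame

end Summit.AtomisticToContinuum.Crystallization.Theorems.ChartedZeroExcessLayeredLatticeLiouville

end
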